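import Summits.CriticalPhenomena.PercolationContinuityZ3.Theorems.PercTiltedBlockersCubeBlockingSeedLadder
import Summits.CriticalPhenomena.PercolationContinuityZ3.Theorems.PercTiltedBlockersCubeBlockingSeedTallSeedOfFlatAnnulusCrossing
import Summits.CriticalPhenomena.PercolationContinuityZ3.Theorems.PercTiltedBlockersTiltComparisonReductions
import HarnessLib

/-!
# Crux `CubeBlockingSeed` (stmt-CriticalPhenomena-1141), line `registered` — ONE shape-uniform height-halving
# comparison serves the whole route, importable

Helper file of the line lead c1 (`--supports stmt-CriticalPhenomena-1141`, registered sub-goal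
`stub_cruxOfFlatAnnulusCrossingOfHeightHalvingAll`). The two OPEN registered stubs of the line are a d = 3
POSITIVITY input (`stub_tallSeed`, the tube seed; implied by the sibling crux `FlatAnnulusCrossing`,
stmt-6699, `stub_tallSeedOfFlatAnnulusCrossing` p149647) and an RSW COMPARISON in the hard direction on TALL
shapes (`stub_tallTilt`, feeding the halving rung `SeedAt (2k) → SeedAt k`). The lead of the sibling crux
`TiltComparison` (stmt-6393) isolated the same kind of input on the FLAT family: the height-halving comparison
`HH` (`g(P(Blocked R(4m;L,M))) ≤ P(Blocked R(2m;L,M))`, `L, M ∈ [4m, 24m]`), with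
`TiltComparison.tiltComparison_of_heightHalving : HH → TiltComparison` (p151087). The flat `HH` does not reach
the tall family (it needs `L, M ≥ height`), and the tall rung does not reach the flat family; this file records
that ONE shape-uniform statement covers both:

`HeightHalvingAll` (written out as a HYPOTHESIS everywhere below; believed OPEN — fixed-factor RSW in the hard
direction at `p_c(ℤ³)`, Benjamini–Kalai 2018 p.71 — and false in no known regime):
`∃ g mono, g > 0 on (0,∞), ∀ h L M ≥ 1, g (P_{p_c}(Blocked R(2h; L, M))) ≤ P_{p_c}(Blocked R(h; L, M))`,
`Blocked R(h;L,M)` = no open path inside `[0,h]×[0,L]×[0,M]` from `{x₀ = 0}` to `{x₀ = h}` (the crux's event).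

* `halvingRung_of_heightHalvingAll` — `HeightHalvingAll →` the halving rung `∀ k ≥ 1, SeedAt (2k) → SeedAt k`
  (registered text of the line's original `stub_halvingRung`): instance `h = k n`, `L = M = n`.
* `cubeBlockingSeed_of_tallSeed_of_heightHalvingAll`, `stub_cruxOfFlatAnnulusCrossingOfHeightHalvingAll`,
  `cubeBlockingSeed_of_flatAnnulusCrossing_of_heightHalvingAll` (+ the `PercTiltedBlockers` twin) — hence
  `TubeSeed ∧ HeightHalvingAll ⟹ CubeBlockingSeed` and `FlatAnnulusCrossing (6699) ∧ HeightHalvingAll ⟹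
  CubeBlockingSeed (1141)`, by the landed ladder (`stub_ladder`, p149603).
* `heightHalvingFlat_of_heightHalvingAll`, `tiltComparison_of_heightHalvingAll` — `HeightHalvingAll → HH →
  TiltComparison (6393)`: instance `h = 2m`.
* `percolationContinuityZ3_of_flatAnnulusCrossing_of_heightHalvingAll` — with the route's deciding theorem
  `Theses.PercTiltedBlockers.closes`: **`FlatAnnulusCrossing ∧ HeightHalvingAll ⟹ θ(p_c) = 0 on ℤ³`**, i.e. modulo
  proved mathematics the route `PercTiltedBlockers` needs exactly one positivity input (6699, flat washers at one
  aspect ratio) and one comparison input (shape-uniform height halving).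

No definitions; no unproved facts are used (every open statement enters as a hypothesis, written out in tree
vocabulary).

## References
* I. Benjamini, G. Kalai (2018) p.71, doi:10.2140/memocs.2018.6.69 ('RSW for plaquettes in cubes', open) [BenjaminiKalai2018].
* C. Borgs, J. Chayes, H. Kesten, J. Spencer, Random Structures Algorithms 15 (1999) §1 (hyperscaling postulates) [BorgsChayesKestenSpencer1999].
* G. Grimmett, *Percolation*, 2nd ed. (1999), §1.4, §7 [Grimmett1999].
-/

noncomputable section

namespace Summit.CriticalPhenomena.PercolationContinuityZ3.Theorems.CubeBlockingSeed

open MeasureTheory Literature.Probability.Percolation Literature.Probability.LatticeModels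
open Summit.CriticalPhenomena.PercolationContinuityZ3.Theses

/-- **The halving rung from shape-uniform height halving**: `HeightHalvingAll → ∀ k ≥ 1, SeedAt (2k) → SeedAt k`
(the registered text of the line's `stub_halvingRung`): at cross-section `n × n`, `β(2kn; n, n) ≥ c` gives
`β(kn; n, n) ≥ g(c)` with the `g` of the hypothesis (instance `h = kn`, `L = M = n`). [folklore] -/
theorem halvingRung_of_heightHalvingAll
    (hHH : ∃ g : ℝ → ℝ, Monotone g ∧ (∀ s, 0 < s → 0 < g s) ∧ ∀ h L M : ℕ, 1 ≤ h → 1 ≤ L → 1 ≤ M →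
      g ((bondPercolation (zdGraph 3) (criticalProbI 3)).real
          {ω | ¬ ∃ x ∈ Finset.Icc (0 : Site 3) ![((2 * h : ℕ) : ℤ), L, M],
            ∃ y ∈ Finset.Icc (0 : Site 3) ![((2 * h : ℕ) : ℤ), L, M],
              x 0 = 0 ∧ y 0 = ((2 * h : ℕ) : ℤ) ∧
                ω ∈ openConnIn ↑(Finset.Icc (0 : Site 3) ![((2 * h : ℕ) : ℤ), L, M]) x y}) ≤
        (bondPercolation (zdGraph 3) (criticalProbI 3)).real
          {ω | ¬ ∃ x ∈ Finset.Icc (0 : Site 3) ![(h : ℤ), L, M],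
            ∃ y ∈ Finset.Icc (0 : Site 3) ![(h : ℤ), L, M],
              x 0 = 0 ∧ y 0 = (h : ℤ) ∧
                ω ∈ openConnIn ↑(Finset.Icc (0 : Site 3) ![(h : ℤ), L, M]) x y}) :
    ∀ k : ℕ, 1 ≤ k →
      (∃ c : ℝ, 0 < c ∧ ∀ n : ℕ, 1 ≤ n → c ≤ (bondPercolation (zdGraph 3) (criticalProbI 3)).real
        {ω | ¬ ∃ x ∈ Finset.Icc (0 : Site 3) ![((2 * k * n : ℕ) : ℤ), ((n : ℕ) : ℤ), ((n : ℕ) : ℤ)],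
          ∃ y ∈ Finset.Icc (0 : Site 3) ![((2 * k * n : ℕ) : ℤ), ((n : ℕ) : ℤ), ((n : ℕ) : ℤ)],
            x 0 = 0 ∧ y 0 = ((2 * k * n : ℕ) : ℤ) ∧
              ω ∈ openConnIn ↑(Finset.Icc (0 : Site 3) ![((2 * k * n : ℕ) : ℤ), ((n : ℕ) : ℤ), ((n : ℕ) : ℤ)]) x y}) →
      (∃ c : ℝ, 0 < c ∧ ∀ n : ℕ, 1 ≤ n → c ≤ (bondPercolation (zdGraph 3) (criticalProbI 3)).real
        {ω | ¬ ∃ x ∈ Finset.Icc (0 : Site 3) ![((k * n : ℕ) : ℤ), ((n : ℕ) : ℤ), ((n : ℕ) : ℤ)],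
          ∃ y ∈ Finset.Icc (0 : Site 3) ![((k * n : ℕ) : ℤ), ((n : ℕ) : ℤ), ((n : ℕ) : ℤ)],
            x 0 = 0 ∧ y 0 = ((k * n : ℕ) : ℤ) ∧
              ω ∈ openConnIn ↑(Finset.Icc (0 : Site 3) ![((k * n : ℕ) : ℤ), ((n : ℕ) : ℤ), ((n : ℕ) : ℤ)]) x y}) := by
  intro k hk h2k
  obtain ⟨g, hgm, hgp, hg⟩ := hHH
  obtain ⟨c, hc, hcle⟩ := h2k
  refine ⟨g c, hgp c hc, fun n hn => ?_⟩
  have hkn : 1 ≤ k * n := Nat.one_le_iff_ne_zero.2 (Nat.mul_ne_zero (by omega) (by omega))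
  have step := hg (k * n) n n hkn hn hn
  have e : 2 * (k * n) = 2 * k * n := (Nat.mul_assoc 2 k n).symm
  rw [e] at step
  exact (hgm (hcle n hn)).trans step

/-- **Tube seed + shape-uniform height halving ⟹ the crux** (route decl `Theses.PercTiltedBlockers.CubeBlockingSeed`
by name): the registered text of `stub_tallSeed` (`∃ k ≥ 1, SeedAt k`) and `HeightHalvingAll` give the crux by the
landed ladder `cubeBlockingSeed_of_tallSeed_of_halvingRung`. [folklore] -/
theorem cubeBlockingSeed_of_tallSeed_of_heightHalvingAll
    (hT : ∃ k : ℕ, 1 ≤ k ∧ (∃ c : ℝ, 0 < c ∧ ∀ n : ℕ, 1 ≤ n → c ≤ (bondPercolation (zdGraph 3) (criticalProbI 3)).real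
        {ω | ¬ ∃ x ∈ Finset.Icc (0 : Site 3) ![((k * n : ℕ) : ℤ), ((n : ℕ) : ℤ), ((n : ℕ) : ℤ)],
          ∃ y ∈ Finset.Icc (0 : Site 3) ![((k * n : ℕ) : ℤ), ((n : ℕ) : ℤ), ((n : ℕ) : ℤ)],
            x 0 = 0 ∧ y 0 = ((k * n : ℕ) : ℤ) ∧
              ω ∈ openConnIn ↑(Finset.Icc (0 : Site 3) ![((k * n : ℕ) : ℤ), ((n : ℕ) : ℤ), ((n : ℕ) : ℤ)]) x y}))
    (hHH : ∃ g : ℝ → ℝ, Monotone g ∧ (∀ s, 0 < s → 0 < g s) ∧ ∀ h L M : ℕ, 1 ≤ h → 1 ≤ L → 1 ≤ M →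
      g ((bondPercolation (zdGraph 3) (criticalProbI 3)).real
          {ω | ¬ ∃ x ∈ Finset.Icc (0 : Site 3) ![((2 * h : ℕ) : ℤ), L, M],
            ∃ y ∈ Finset.Icc (0 : Site 3) ![((2 * h : ℕ) : ℤ), L, M],
              x 0 = 0 ∧ y 0 = ((2 * h : ℕ) : ℤ) ∧
                ω ∈ openConnIn ↑(Finset.Icc (0 : Site 3) ![((2 * h : ℕ) : ℤ), L, M]) x y}) ≤
        (bondPercolation (zdGraph 3) (criticalProbI 3)).real
          {ω | ¬ ∃ x ∈ Finset.Icc (0 : Site 3) ![(h : ℤ), L, M],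
            ∃ y ∈ Finset.Icc (0 : Site 3) ![(h : ℤ), L, M],
              x 0 = 0 ∧ y 0 = (h : ℤ) ∧
                ω ∈ openConnIn ↑(Finset.Icc (0 : Site 3) ![(h : ℤ), L, M]) x y}) :
    PercTiltedBlockers.CubeBlockingSeed :=
  cubeBlockingSeed_of_tallSeed_of_halvingRung hT (halvingRung_of_heightHalvingAll hHH)

/-- **`stub_cruxOfFlatAnnulusCrossingOfHeightHalvingAll`** (registered sub-goal of crux stmt-CriticalPhenomena-1141):
`FlatAnnulusCrossing` (stmt-6699) and `HeightHalvingAll` imply the crux's body (`∃ c > 0, ∀ n ≥ 1,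
c ≤ P_{p_c}([0,n]³ blocked face-to-face)`): tube seed from 6699 (`stub_tallSeedOfFlatAnnulusCrossing`), halving rungs
from height halving (`halvingRung_of_heightHalvingAll`), and the ladder (`stub_ladder`). [folklore] -/
theorem stub_cruxOfFlatAnnulusCrossingOfHeightHalvingAll :
    PercDivergentSlabLadder.FlatAnnulusCrossing →
      (∃ g : ℝ → ℝ, Monotone g ∧ (∀ s, 0 < s → 0 < g s) ∧ ∀ h L M : ℕ, 1 ≤ h → 1 ≤ L → 1 ≤ M →
        g ((bondPercolation (zdGraph 3) (criticalProbI 3)).real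
            {ω | ¬ ∃ x ∈ Finset.Icc (0 : Site 3) ![((2 * h : ℕ) : ℤ), L, M],
              ∃ y ∈ Finset.Icc (0 : Site 3) ![((2 * h : ℕ) : ℤ), L, M],
                x 0 = 0 ∧ y 0 = ((2 * h : ℕ) : ℤ) ∧
                  ω ∈ openConnIn ↑(Finset.Icc (0 : Site 3) ![((2 * h : ℕ) : ℤ), L, M]) x y}) ≤
          (bondPercolation (zdGraph 3) (criticalProbI 3)).real
            {ω | ¬ ∃ x ∈ Finset.Icc (0 : Site 3) ![(h : ℤ), L, M],
              ∃ y ∈ Finset.Icc (0 : Site 3) ![(h : ℤ), L, M],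
                x 0 = 0 ∧ y 0 = (h : ℤ) ∧
                  ω ∈ openConnIn ↑(Finset.Icc (0 : Site 3) ![(h : ℤ), L, M]) x y}) →
      ∃ c : ℝ, 0 < c ∧ ∀ n : ℕ, 1 ≤ n → c ≤ (bondPercolation (zdGraph 3) (criticalProbI 3)).real
        {ω | ¬ ∃ x ∈ Finset.Icc (0 : Site 3) ![(n : ℤ), n, n], ∃ y ∈ Finset.Icc (0 : Site 3) ![(n : ℤ), n, n],
          x 0 = 0 ∧ y 0 = n ∧ ω ∈ openConnIn ↑(Finset.Icc (0 : Site 3) ![(n : ℤ), n, n]) x y} :=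
  fun h6699 hHH => stub_ladder (stub_tallSeedOfFlatAnnulusCrossing h6699) (halvingRung_of_heightHalvingAll hHH)

/-- `FlatAnnulusCrossing (6699) ∧ HeightHalvingAll ⟹ CubeBlockingSeed`, concluding the item's primary decl
`Theses.PercAnnulusCrossing.CubeBlockingSeed` by name. [folklore] -/
theorem cubeBlockingSeed_of_flatAnnulusCrossing_of_heightHalvingAll
    (h6699 : PercDivergentSlabLadder.FlatAnnulusCrossing)
    (hHH : ∃ g : ℝ → ℝ, Monotone g ∧ (∀ s, 0 < s → 0 < g s) ∧ ∀ h L M : ℕ, 1 ≤ h → 1 ≤ L → 1 ≤ M →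
      g ((bondPercolation (zdGraph 3) (criticalProbI 3)).real
          {ω | ¬ ∃ x ∈ Finset.Icc (0 : Site 3) ![((2 * h : ℕ) : ℤ), L, M],
            ∃ y ∈ Finset.Icc (0 : Site 3) ![((2 * h : ℕ) : ℤ), L, M],
              x 0 = 0 ∧ y 0 = ((2 * h : ℕ) : ℤ) ∧
                ω ∈ openConnIn ↑(Finset.Icc (0 : Site 3) ![((2 * h : ℕ) : ℤ), L, M]) x y}) ≤
        (bondPercolation (zdGraph 3) (criticalProbI 3)).real
          {ω | ¬ ∃ x ∈ Finset.Icc (0 : Site 3) ![(h : ℤ), L, M],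
            ∃ y ∈ Finset.Icc (0 : Site 3) ![(h : ℤ), L, M],
              x 0 = 0 ∧ y 0 = (h : ℤ) ∧
                ω ∈ openConnIn ↑(Finset.Icc (0 : Site 3) ![(h : ℤ), L, M]) x y}) :
    PercAnnulusCrossing.CubeBlockingSeed :=
  stub_cruxOfFlatAnnulusCrossingOfHeightHalvingAll h6699 hHH

/-- The same for the verbatim twin `Theses.PercTiltedBlockers.CubeBlockingSeed`. [folklore] -/
theorem cubeBlockingSeed'_of_flatAnnulusCrossing_of_heightHalvingAll
    (h6699 : PercDivergentSlabLadder.FlatAnnulusCrossing)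
    (hHH : ∃ g : ℝ → ℝ, Monotone g ∧ (∀ s, 0 < s → 0 < g s) ∧ ∀ h L M : ℕ, 1 ≤ h → 1 ≤ L → 1 ≤ M →
      g ((bondPercolation (zdGraph 3) (criticalProbI 3)).real
          {ω | ¬ ∃ x ∈ Finset.Icc (0 : Site 3) ![((2 * h : ℕ) : ℤ), L, M],
            ∃ y ∈ Finset.Icc (0 : Site 3) ![((2 * h : ℕ) : ℤ), L, M],
              x 0 = 0 ∧ y 0 = ((2 * h : ℕ) : ℤ) ∧
                ω ∈ openConnIn ↑(Finset.Icc (0 : Site 3) ![((2 * h : ℕ) : ℤ), L, M]) x y}) ≤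
        (bondPercolation (zdGraph 3) (criticalProbI 3)).real
          {ω | ¬ ∃ x ∈ Finset.Icc (0 : Site 3) ![(h : ℤ), L, M],
            ∃ y ∈ Finset.Icc (0 : Site 3) ![(h : ℤ), L, M],
              x 0 = 0 ∧ y 0 = (h : ℤ) ∧
                ω ∈ openConnIn ↑(Finset.Icc (0 : Site 3) ![(h : ℤ), L, M]) x y}) :
    PercTiltedBlockers.CubeBlockingSeed :=
  stub_cruxOfFlatAnnulusCrossingOfHeightHalvingAll h6699 hHH

/-- **Shape-uniform height halving gives the flat-family height halving `HH`** of the sibling crux's lead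
(the hypothesis of `TiltComparison.tiltComparison_of_heightHalving`, verbatim): instance `h = 2m`
(`(2·(2m) : ℤ) = 4m`). [folklore] -/
theorem heightHalvingFlat_of_heightHalvingAll
    (hHH : ∃ g : ℝ → ℝ, Monotone g ∧ (∀ s, 0 < s → 0 < g s) ∧ ∀ h L M : ℕ, 1 ≤ h → 1 ≤ L → 1 ≤ M →
      g ((bondPercolation (zdGraph 3) (criticalProbI 3)).real
          {ω | ¬ ∃ x ∈ Finset.Icc (0 : Site 3) ![((2 * h : ℕ) : ℤ), L, M],
            ∃ y ∈ Finset.Icc (0 : Site 3) ![((2 * h : ℕ) : ℤ), L, M],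
              x 0 = 0 ∧ y 0 = ((2 * h : ℕ) : ℤ) ∧
                ω ∈ openConnIn ↑(Finset.Icc (0 : Site 3) ![((2 * h : ℕ) : ℤ), L, M]) x y}) ≤
        (bondPercolation (zdGraph 3) (criticalProbI 3)).real
          {ω | ¬ ∃ x ∈ Finset.Icc (0 : Site 3) ![(h : ℤ), L, M],
            ∃ y ∈ Finset.Icc (0 : Site 3) ![(h : ℤ), L, M],
              x 0 = 0 ∧ y 0 = (h : ℤ) ∧
                ω ∈ openConnIn ↑(Finset.Icc (0 : Site 3) ![(h : ℤ), L, M]) x y}) :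
    ∃ g : ℝ → ℝ, Monotone g ∧ (∀ s, 0 < s → 0 < g s) ∧ ∀ m L M : ℕ, 1 ≤ m → 4 * m ≤ L →
      L ≤ 24 * m → 4 * m ≤ M → M ≤ 24 * m →
        g ((bondPercolation (zdGraph 3) (criticalProbI 3)).real
            {ω | ¬ ∃ x ∈ Finset.Icc (0 : Site 3) ![4 * (m : ℤ), L, M],
              ∃ y ∈ Finset.Icc (0 : Site 3) ![4 * (m : ℤ), L, M],
                x 0 = 0 ∧ y 0 = 4 * m ∧
                  ω ∈ openConnIn ↑(Finset.Icc (0 : Site 3) ![4 * (m : ℤ), L, M]) x y}) ≤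
          (bondPercolation (zdGraph 3) (criticalProbI 3)).real
            {ω | ¬ ∃ x ∈ Finset.Icc (0 : Site 3) ![2 * (m : ℤ), L, M],
              ∃ y ∈ Finset.Icc (0 : Site 3) ![2 * (m : ℤ), L, M],
                x 0 = 0 ∧ y 0 = 2 * m ∧
                  ω ∈ openConnIn ↑(Finset.Icc (0 : Site 3) ![2 * (m : ℤ), L, M]) x y} := by
  obtain ⟨g, hgm, hgp, hg⟩ := hHH
  refine ⟨g, hgm, hgp, fun m L M hm hL _ hM _ => ?_⟩
  have step := hg (2 * m) L M (by omega) (by omega) (by omega)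
  have e1 : ((2 * (2 * m) : ℕ) : ℤ) = 4 * (m : ℤ) := by push_cast; ring
  have e2 : ((2 * m : ℕ) : ℤ) = 2 * (m : ℤ) := by push_cast; ring
  simp only [e1, e2] at step
  exact step

/-- **Shape-uniform height halving gives the sibling crux `TiltComparison`** (stmt-CriticalPhenomena-6393, route decl
by name), by the 6393 lead's landed `TiltComparison.tiltComparison_of_heightHalving` (p151087). [folklore] -/
theorem tiltComparison_of_heightHalvingAll
    (hHH : ∃ g : ℝ → ℝ, Monotone g ∧ (∀ s, 0 < s → 0 < g s) ∧ ∀ h L M : ℕ, 1 ≤ h → 1 ≤ L → 1 ≤ M →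
      g ((bondPercolation (zdGraph 3) (criticalProbI 3)).real
          {ω | ¬ ∃ x ∈ Finset.Icc (0 : Site 3) ![((2 * h : ℕ) : ℤ), L, M],
            ∃ y ∈ Finset.Icc (0 : Site 3) ![((2 * h : ℕ) : ℤ), L, M],
              x 0 = 0 ∧ y 0 = ((2 * h : ℕ) : ℤ) ∧
                ω ∈ openConnIn ↑(Finset.Icc (0 : Site 3) ![((2 * h : ℕ) : ℤ), L, M]) x y}) ≤
        (bondPercolation (zdGraph 3) (criticalProbI 3)).real
          {ω | ¬ ∃ x ∈ Finset.Icc (0 : Site 3) ![(h : ℤ), L, M],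
            ∃ y ∈ Finset.Icc (0 : Site 3) ![(h : ℤ), L, M],
              x 0 = 0 ∧ y 0 = (h : ℤ) ∧
                ω ∈ openConnIn ↑(Finset.Icc (0 : Site 3) ![(h : ℤ), L, M]) x y}) :
    PercTiltedBlockers.TiltComparison :=
  TiltComparison.tiltComparison_of_heightHalving (heightHalvingFlat_of_heightHalvingAll hHH)

/-- **`FlatAnnulusCrossing ∧ HeightHalvingAll ⟹ θ(p_c) = 0 on ℤ³`**: the route's deciding theorem
`Theses.PercTiltedBlockers.closes` needs exactly `TiltComparison` (from height halving alone) and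
`CubeBlockingSeed` (from 6699 and height halving). A CONDITIONAL reduction: both hypotheses are open. [folklore] -/
theorem percolationContinuityZ3_of_flatAnnulusCrossing_of_heightHalvingAll
    (h6699 : PercDivergentSlabLadder.FlatAnnulusCrossing)
    (hHH : ∃ g : ℝ → ℝ, Monotone g ∧ (∀ s, 0 < s → 0 < g s) ∧ ∀ h L M : ℕ, 1 ≤ h → 1 ≤ L → 1 ≤ M →
      g ((bondPercolation (zdGraph 3) (criticalProbI 3)).real
          {ω | ¬ ∃ x ∈ Finset.Icc (0 : Site 3) ![((2 * h : ℕ) : ℤ), L, M],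
            ∃ y ∈ Finset.Icc (0 : Site 3) ![((2 * h : ℕ) : ℤ), L, M],
              x 0 = 0 ∧ y 0 = ((2 * h : ℕ) : ℤ) ∧
                ω ∈ openConnIn ↑(Finset.Icc (0 : Site 3) ![((2 * h : ℕ) : ℤ), L, M]) x y}) ≤
        (bondPercolation (zdGraph 3) (criticalProbI 3)).real
          {ω | ¬ ∃ x ∈ Finset.Icc (0 : Site 3) ![(h : ℤ), L, M],
            ∃ y ∈ Finset.Icc (0 : Site 3) ![(h : ℤ), L, M],
              x 0 = 0 ∧ y 0 = (h : ℤ) ∧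
                ω ∈ openConnIn ↑(Finset.Icc (0 : Site 3) ![(h : ℤ), L, M]) x y}) :
    _root_.PercolationContinuityZ3 :=
  PercTiltedBlockers.closes (tiltComparison_of_heightHalvingAll hHH)
    (cubeBlockingSeed'_of_flatAnnulusCrossing_of_heightHalvingAll h6699 hHH)

end Summit.CriticalPhenomena.PercolationContinuityZ3.Theorems.CubeBlockingSeed

end
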